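import Summits.ValiantsHypothesis.ValiantsHypothesis.Theorems.LangWeilTransferTameResolutionFlatSizes
import Summits.ValiantsHypothesis.ValiantsHypothesis.Theorems.LangWeilTransferTameResolutionFactorWeight

/-!
# LangWeilTransfer, support item `TameResolution` (stmt-ValiantsHypothesis-6378) — sizes of a
# factor `q ∣ P` in `ℤ[X_1..X_k][U]`

Route `LangWeilTransfer` of `ValiantsHypothesis` (conditional route; honest framing: bookkeeping,
nothing here bears on VP ≠ VNP). Quantitative pass (roadmap note of val-lit-p6 g9, §1(B)), the two
factor steps `q ∣ 𝒬_a` and `Q ∣ q_c` of `exists_parametrisation_explicit`: from the `U`-degree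
`≤ N`, coefficient total degrees `≤ D` and coefficient weights `≤ W` of `P ≠ 0`, every factor `q`
has `U`-degree `≤ N`, coefficient degrees `≤ D + N` and coefficient weights
`≤ (N+1) W ((D+N+1)(2(D+N)+1)^{2(D+N)})^{k+1}` — by flattening (`LangWeilTransferTameResolutionFlatSizes`)
and val-width's elementary factor weight bound `weight_le_of_dvd`
(`LangWeilTransferTameResolutionFactorWeight`).

* `factor_sizes`.
-/

noncomputable section

open MvPolynomial
open Literature.Computability.AlgebraicComplexity

-- the summit and the problem share the name `ValiantsHypothesis` (D-0017 single-conjunct layout)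
set_option linter.dupNamespace false

namespace Summit.ValiantsHypothesis.ValiantsHypothesis.Theorems.LangWeilTransfer

/-- **Sizes of a factor.** See the module docstring. -/
theorem factor_sizes {k : ℕ} (P q : Polynomial (MvPolynomial (Fin k) ℤ)) (hP : P ≠ 0) (hq : q ∣ P)
    {N D W : ℕ} (hN : P.natDegree ≤ N) (hD : ∀ i, (P.coeff i).totalDegree ≤ D)
    (hW : ∀ i, weight (P.coeff i) ≤ W) :
    q.natDegree ≤ N ∧ (∀ i, (q.coeff i).totalDegree ≤ D + N) ∧
      ∀ i, weight (q.coeff i) ≤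
        (N + 1) * W * (((D + N) + 1) * (2 * (D + N) + 1) ^ (2 * (D + N))) ^ (k + 1) := by
  have hqN : q.natDegree ≤ N := (Polynomial.natDegree_le_of_dvd hq hP).trans hN
  set Pf := (finSuccEquiv ℤ k).symm P with hPf
  set qf := (finSuccEquiv ℤ k).symm q with hqf
  have hPf0 : Pf ≠ 0 := by
    rw [hPf]; exact (EmbeddingLike.map_ne_zero_iff).2 hP
  have hdvd : qf ∣ Pf := by rw [hqf, hPf]; exact map_dvd _ hq
  have hPfdeg : Pf.totalDegree ≤ D + N := totalDegree_finSuccEquiv_symm_le P hN hD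
  have hqfdeg : qf.totalDegree ≤ D + N := (totalDegree_le_of_dvd_of_isDomain hdvd hPf0).trans hPfdeg
  refine ⟨hqN, fun i => (totalDegree_coeff_le_flat q i).trans hqfdeg, fun i => ?_⟩
  refine (weight_coeff_le_flat q i).trans ?_
  have h := weight_le_of_dvd (k + 1) Pf qf hPf0 hdvd (fun v => (degreeOf_flat_le P v).trans hPfdeg)
  refine h.trans (Nat.mul_le_mul_right _ ?_)
  exact weight_finSuccEquiv_symm_le P hN hW

end Summit.ValiantsHypothesis.ValiantsHypothesis.Theorems.LangWeilTransfer
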